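import Mathlib.Analysis.SpecificLimits.Basic
import Mathlib.Analysis.InnerProductSpace.PiL2

/-!
# Route `ExcessDecayLiouville`: telescoping of the approximants across the scales (nonlinear half, XXXII)

Harmonic-replacement architecture for item `ExcessDecay` (stmt-AtomisticToContinuum-9334), nonlinear half.
The scale induction compares the displacement with the approximant of an EARLIER scale through the
increments of the intermediate steps; the increments decay geometrically.  Pure bookkeeping:
* `norm_sub_telescope` : `‖u − f j‖ ≤ ‖u − f i‖ + Σ_{i ≤ m < j} ‖f (m+1) − f m‖`;
* `geom_sum_Ico_le` : `Σ_{i ≤ m < j} c q^m ≤ c q^i / (1 − q)` (`0 ≤ q < 1`, `c ≥ 0`);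
* `norm_sub_telescope_geom` : the combination.
All `[folklore]`; helper lemmas, nothing here closes an item.
-/

noncomputable section

namespace Summit.AtomisticToContinuum.Crystallization.Theorems.ExcessDecayLiouville

open scoped BigOperators

/-- **Telescoping through the intermediate approximants.** [folklore] -/
theorem norm_sub_telescope {E : Type*} [SeminormedAddCommGroup E] (u : E) (f : ℕ → E) {i j : ℕ} (hij : i ≤ j) :
    ‖u - f j‖ ≤ ‖u - f i‖ + ∑ m ∈ Finset.Ico i j, ‖f (m + 1) - f m‖ := by
  induction j, hij using Nat.le_induction with
  | base => simp
  | succ n hn ih =>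
    rw [Finset.sum_Ico_succ_top hn]
    calc ‖u - f (n + 1)‖ = ‖(u - f n) - (f (n + 1) - f n)‖ := by congr 1; abel
      _ ≤ ‖u - f n‖ + ‖f (n + 1) - f n‖ := norm_sub_le _ _
      _ ≤ _ := by linarith

/-- **A geometric sum over a window.** [folklore] -/
theorem geom_sum_Ico_le {c q : ℝ} (hc : 0 ≤ c) (hq0 : 0 ≤ q) (hq1 : q < 1) (i j : ℕ) :
    ∑ m ∈ Finset.Ico i j, c * q ^ m ≤ c * q ^ i / (1 - q) := by
  have h1q : 0 < 1 - q := by linarith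
  by_cases hij : i ≤ j
  · -- shift to a range sum
    have hshift : ∑ m ∈ Finset.Ico i j, c * q ^ m = c * q ^ i * ∑ k ∈ Finset.range (j - i), q ^ k := by
      rw [Finset.sum_Ico_eq_sum_range, Finset.mul_sum]
      exact Finset.sum_congr rfl fun k _ => by rw [pow_add]; ring
    rw [hshift]
    have hgeom : ∑ k ∈ Finset.range (j - i), q ^ k ≤ (1 - q)⁻¹ := by
      rw [← tsum_geometric_of_lt_one hq0 hq1]
      exact (summable_geometric_of_lt_one hq0 hq1).sum_le_tsum _ fun k _ => pow_nonneg hq0 k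
    rw [div_eq_mul_inv]
    exact mul_le_mul_of_nonneg_left hgeom (by positivity)
  · rw [Finset.Ico_eq_empty (fun h => hij h.le), Finset.sum_empty]
    positivity

/-- **Telescoping with geometric increments**: if `‖f (m+1) − f m‖ ≤ c q^m` for `i ≤ m < j`, then
`‖u − f j‖ ≤ ‖u − f i‖ + c q^i/(1 − q)`. [folklore] -/
theorem norm_sub_telescope_geom {E : Type*} [SeminormedAddCommGroup E] (u : E) (f : ℕ → E) {i j : ℕ} (hij : i ≤ j)
    {c q : ℝ} (hc : 0 ≤ c) (hq0 : 0 ≤ q) (hq1 : q < 1)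
    (hinc : ∀ m, i ≤ m → m < j → ‖f (m + 1) - f m‖ ≤ c * q ^ m) :
    ‖u - f j‖ ≤ ‖u - f i‖ + c * q ^ i / (1 - q) := by
  refine (norm_sub_telescope u f hij).trans (add_le_add le_rfl ?_)
  refine le_trans (Finset.sum_le_sum fun m hm => ?_) (geom_sum_Ico_le hc hq0 hq1 i j)
  rw [Finset.mem_Ico] at hm
  exact hinc m hm.1 hm.2

end Summit.AtomisticToContinuum.Crystallization.Theorems.ExcessDecayLiouville

end
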